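import Mathlib.Algebra.Order.Archimedean.Real.Basic
import Mathlib.Order.ConditionallyCompleteLattice.Basic
import Mathlib.Algebra.Order.BigOperators.Ring.Finset
import Mathlib.Algebra.Order.Field.Basic
import Mathlib.Order.Interval.Finset.Nat
import Mathlib.Order.ConditionallyCompleteLattice.Indexed
import Mathlib.Tactic.Linarith
import Mathlib.Tactic.FieldSimp
import Mathlib.Tactic.Ring
import Mathlib.Tactic.Positivity
import Mathlib.Topology.Order.Compact
import Mathlib.Topology.Instances.Real.Lemmas
import Literature.MathematicalPhysics.QuantumFieldTheory.Volkov2020.CapturedPhotonBound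
import Literature.MathematicalPhysics.QuantumFieldTheory.Volkov2020.DenominatorLemmaArithmetic
import HarnessLib

/-!
# Volkov 2020 (NPB 961, 115232) §3.2 Lemma 3.4 WITH footnote 23 («This inequality works in both directions too») — PROVED for the on-shell denominator W(z) = m²(Z(z) − Z₀(z)) of eq. (2.4), Z taken in Thomson's form (the infimum of the dissipated power over unit flows) on the lepton-path circuit of a QED graph without lepton loops: (m²/2)·max_i (z′_i)²/max(z′_i, z_i) ≤ |W(z)| ≤ m²·Σ_i |LPath(i)|²·(z′_i)²/max(z′_i, z_i)

independent recomputation; certified where stated, statistical where stated; no new-physics claim.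

CITATION HEADER (venture `QEDPrecision`, cell `pub-qed`, track TROPICAL seat V3b = `pub-qed-trop-v3-lit-2` gen 8; VALUE-FREE: an inequality between
resistances of an abstract circuit — no integrand, nothing per word). Companion of `Volkov2020.DenominatorLemmaArithmetic` (the printed proof's
arithmetic: Z₀ − Z_i = (z″_i)²/(z″_i + z_i), z′ ≤ z″ ≤ n·z′, the constants ½ and n²; reused here) and `Volkov2020.CapturedPhotonBound` (the lepton-path
skeleton `PathSkeleton`: vertices 0…N, lepton line k joins k and k+1, internal photons as vertex pairs (u, v), LPath((u,v)) = lines u…v−1). Serves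
`tropical/view/V3-VOLKOV-DEGREES.md` §B B.30 and ORACLE-RULE (4c)'s «val(W) closed form DERIVED from Lemma 3.4 (3.3) with fn 23» (T1 L1 (b)).

Source. [Volkov2020] S. Volkov, "Infrared and ultraviolet power counting on the mass shell in quantum electrodynamics", Nucl. Phys. B 961
(2020) 115232 = arXiv:1912.04885v4 (e-print tex `iclos_arxiv.tex` held by the cell; journal pages from the cell's SCOAP3 page files), VERBATIM:
* §2.2.1, last rule (journal p.9; tex l.237): "W(z,p,ε) from (1.3) is obtained using the electric circuit analogy [Bjorken–Drell, Ch. 18 §18.4].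
  Namely, Σ_{j,l} A_{jl} p_j p_l from (1.4) equals the electrical power that is absorbed within the circuit with topology G, line resistances z_l,
  external currents p_1, …, p_n."
* §2.2.2 **eq. (2.4)** (journal p.10; tex l.261–264): "W(z) = m²(Z(z) − Z₀(z)), where Z(z) is the resistance between the vertexes that are incident
  to the external lepton lines of the electric circuit with topology G, line resistances z_l; Z₀(z) = Σ_{l∈Lept(E(G))} z_l is the resistance of the
  corresponding circuit with removed photon lines."
* §3.2 **Lemma 3.4** (journal p.12; tex l.362–372): "The following inequality is satisfied [fn 23: This inequality works in both directions too.] for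
  (2.3): |W(z)| ≥ C·max_{i∈Ph(E(G))} (z′_i)²/max(z′_i, z_i), (3.3) where z′_i = max_{l∈LPath(i)} z_l, C > 0 is some constant depending only on the
  structure of the graph (and m)." Proof (tex l.373–393): "Take i on which the maximum (3.3) is reached. By Z_i(z) we denote the resistance
  between the points incident to the external lepton lines of the electric circuit with the graph that is obtained from G by removing all photon
  lines except i (and the resistances z_l). It is obvious that Z(z) ≤ Z_i(z) ≤ Z₀(z) … Thus, |W(z)| ≥ m²(Z₀(z) − Z_i(z)) = m²(z″_i − z_i z″_i/(z_i +
  z″_i)) = m²(z″_i)²/(z″_i + z_i), where z″_i = Σ_{l∈LPath(i)} z_l. The proof is completed taking into account that max_i a_i ≤ Σ_i a_i ≤ n·max_i a_i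
  for any a_1, …, a_n ≥ 0."

THE ONE MODELLING STEP (flagged): the circuit is the lepton path 0 — 1 — ⋯ — N (line k of resistance `zl k` joins the vertices k, k+1; the
external lepton lines enter at the end vertices 0 and N) with every internal photon i = (u, v) a chord of resistance `zγ i` between u and v
(`PathSkeleton` of `CapturedPhotonBound`; LPath(i) = `Finset.Ico u v`). Z is taken in THOMSON'S FORM: the infimum over unit flows from 0 to N of the
dissipated power Σ_e z_e θ_e² (`effRes`); on this circuit a unit flow is exactly «current t_i through chord i, current 1 − Σ_{i : k∈LPath(i)} t_i
through lepton line k» for an arbitrary real vector t (the chord cycles span the cycle space), so no Kirchhoff system is needed for the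
bounds. That this infimum is the Kirchhoff resistance of the §2.2.1 rule is Thomson's principle of circuit theory [cite: Grimmett2018, Ch. 1,
Lemma 1.25 («the effective resistance … equals the dissipated energy when a unit flow passes from s to t»), Thm 1.28 (Thomson principle), Thm 1.29
(Rayleigh principle)] [cite: LyonsPeres2016, §2.4 «Thomson's Principle», «Rayleigh's Monotonicity Principle»] — PROVED below for this circuit
(sections `Thomson`, `Existence`: a current distribution obeying Kirchhoff's laws exists, attains the infimum, and Z is its voltage drop between
the external vertices at unit current); the cut bound of the upper direction is the Nash-Williams inequality [cite: LyonsPeres2016, §2.5 «The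
Nash-Williams Inequality» (2.13)] with each chord subdivided into |LPath(i)| equal pieces. Z₀ is taken AS PRINTED, Σ_{lepton lines} z_l (it is
the power of the flow t = 0).

WHAT THE KERNEL CERTIFIES (for every `PathSkeleton`, all resistances > 0, every m): `effRes_le_energy` (Z ≤ the power of any unit flow — this is
all of «Z ≤ Z_i ≤ Z₀» the printed proof uses, Rayleigh's monotonicity being built into the infimum); `effRes_le_Z0`, `W_nonpos` (W ≤ 0: the constant
sign of the on-shell denominator); **`effRes_le_singleChord`**: Z ≤ Z₀ − z″_i + z_i z″_i/(z_i + z″_i) for every photon i (the flow through the one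
chord i with the optimal split t_i = z″_i/(z_i + z″_i)); hence **`lemma34_lower`**: (m²/2)·(z′_i)²/max(z′_i, z_i) ≤ |W| for every photon i and
**`lemma34`**: (m²/2)·max_i (z′_i)²/max(z′_i, z_i) ≤ |W| — Lemma 3.4 with the explicit constant C = m²/2 of `DenominatorLemmaArithmetic`; and the
CONVERSE of footnote 23, which the paper asserts without proof: **`energy_ge_cutBound`** (a Nash-Williams cut bound: every unit flow dissipates at least
Σ_k (1/z_k + Σ_{i : k∈LPath(i)} |LPath(i)|/z_i)⁻¹ — per lepton line k the currents through k and through the chords over k add up to 1, and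
Cauchy–Schwarz in Sedrakyan's form), **`Z0_sub_effRes_le`**: Z₀ − Z ≤ Σ_i |LPath(i)|²·(z′_i)²/max(z′_i, z_i), i.e. **`lemma34_upper`**: |W| ≤
m²·Σ_{i∈Ph(E(G))} |LPath(i)|²·(z′_i)²/max(z′_i, z_i) ≤ m²·(Σ_i |LPath(i)|²)·max_i (z′_i)²/max(z′_i, z_i) (`lemma34_two_sided`). So (3.3) IS two-sided,
with constants ½ and Σ_i |LPath(i)|² depending only on the structure of the graph, exactly as footnote 23 says; in valuations this is ORACLE-RULE
(4c)'s val(Z₀ − Z) = min_i max(y′_i, 2y′_i − y_i).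
THOMSON'S PRINCIPLE ON THIS CIRCUIT (section `Thomson`): `KVL` = Kirchhoff's voltage law for the chord currents (the current law holds
identically); `energy_eq_of_KVL`: energy(t) = energy(t⋆) + Σ z(i − i⋆)² ≥ energy(t⋆) for a Kirchhoff distribution t⋆, hence
**`effRes_eq_energy_of_KVL`** (the physical currents attain the infimum) and **`effRes_eq_voltage_of_KVL`**: Z = Σ_k z_k·i⋆_k = the potential
difference between the external vertices at unit current — so `effRes` IS eq. (2.4)'s «resistance between the vertexes» as soon as the
physical current distribution (a solution of Kirchhoff's laws) is given.
EXISTENCE (section `Existence`): `exists_isMin` (the infimum is attained — continuity on the compact box |t_i| ≤ Z₀/z_i + 1, outside of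
which one chord alone dissipates more than Z₀), `KVL_of_isMin` (a minimiser obeys the voltage law: first variation along a chord cycle),
`exists_KVL`, and **`effRes_is_resistance`**: unconditionally there is a Kirchhoff current distribution, it attains Z, and Z is its voltage drop
between the external vertices at unit current — i.e. `effRes` is eq. (2.4)'s Z.
NOT claimed: the Feynman-parametric derivation of (2.4) itself (§2.2.2: that the Feynman denominator of the magnetic-moment integrand IS m²(Z − Z₀));
anything with lepton loops or with external currents other than the magnetic-moment kinematics; uniqueness of the Kirchhoff distribution.
-/

namespace Literature.MathematicalPhysics.QuantumFieldTheory.Volkov2020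

open Finset

namespace PathSkeleton

variable (G : PathSkeleton)

/-- The photons OVER lepton line k: those whose lepton path contains k (the chords bridging the cut between the vertices k and k+1).
[cite: Volkov2020, §2.1 LPath (journal p.7; tex l.166–170)] -/
def over (k : ℕ) : Finset (ℕ × ℕ) := G.ph.filter fun i => k ∈ Finset.Ico i.1 i.2

/-- |LPath(i)| = v − u, the number of lepton lines under photon i = (u, v) (the «n» of the printed max ≤ Σ ≤ n·max step, per photon).
[cite: Volkov2020, proof of Lemma 3.4 (journal p.12; tex l.389–392)] -/
def nPath (i : ℕ × ℕ) : ℝ := ((i.2 - i.1 : ℕ) : ℝ)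

/-- The current through lepton line k of the unit flow 0 → N with chord currents t: 1 − Σ_{i over k} t_i (Kirchhoff's current law solved on the
path-with-chords circuit). [cite: Volkov2020, §2.2.1 «electric circuit analogy» (journal p.9; tex l.237)] -/
def lineCurrent (t : ℕ × ℕ → ℝ) (k : ℕ) : ℝ := 1 - ∑ i ∈ G.over k, t i

/-- The dissipated power Σ_l z_l·(current)² of that unit flow («the electrical power that is absorbed within the circuit»).
[cite: Volkov2020, §2.2.1 (journal p.9; tex l.237)] -/
def energy (zl : ℕ → ℝ) (zγ : ℕ × ℕ → ℝ) (t : ℕ × ℕ → ℝ) : ℝ :=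
  ∑ k ∈ range G.N, zl k * G.lineCurrent t k ^ 2 + ∑ i ∈ G.ph, zγ i * t i ^ 2

/-- **Z(z) in Thomson's form**: the infimum of the dissipated power over all unit flows between the end vertices of the lepton path (the modelling
step of this file; = the resistance between the vertices incident to the external lepton lines by Thomson's principle [cite: Grimmett2018, Ch. 1
Lemma 1.25, Thm 1.28]). [cite: Volkov2020, eq. (2.4) «Z(z) is the resistance between the vertexes that are incident to the external lepton lines» (journal p.10; tex l.261–264)] -/
noncomputable def effRes (zl : ℕ → ℝ) (zγ : ℕ × ℕ → ℝ) : ℝ := ⨅ t : ℕ × ℕ → ℝ, G.energy zl zγ t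

/-- **Z₀(z) AS PRINTED**: Σ_{l∈Lept(E(G))} z_l, «the resistance of the corresponding circuit with removed photon lines».
[cite: Volkov2020, eq. (2.4) (journal p.10; tex l.263–264)] -/
def Z0 (zl : ℕ → ℝ) : ℝ := ∑ k ∈ range G.N, zl k

/-- **W(z) = m²(Z(z) − Z₀(z))**, eq. (2.4). [cite: Volkov2020, eq. (2.4) (journal p.10; tex l.261–262)] -/
noncomputable def W (m : ℝ) (zl : ℕ → ℝ) (zγ : ℕ × ℕ → ℝ) : ℝ := m ^ 2 * (G.effRes zl zγ - G.Z0 zl)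

/-- z″_i = Σ_{l∈LPath(i)} z_l. [cite: Volkov2020, proof of Lemma 3.4 (journal p.12; tex l.385–387)] -/
def zSum (zl : ℕ → ℝ) (i : ℕ × ℕ) : ℝ := ∑ k ∈ Finset.Ico i.1 i.2, zl k

/-- z′_i = max_{l∈LPath(i)} z_l (junk 0 for an empty path). [cite: Volkov2020, Lemma 3.4 (journal p.12; tex l.366–368)] -/
def zMax (zl : ℕ → ℝ) (i : ℕ × ℕ) : ℝ :=
  if h : (Finset.Ico i.1 i.2).Nonempty then (Finset.Ico i.1 i.2).sup' h zl else 0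

/-- The printed comparison quantity (z′_i)²/max(z′_i, z_i) of (3.3). [cite: Volkov2020, Lemma 3.4 eq. (3.3) (journal p.12; tex l.364–365)] -/
noncomputable def f33 (zl : ℕ → ℝ) (zγ : ℕ × ℕ → ℝ) (i : ℕ × ℕ) : ℝ := zMax zl i ^ 2 / max (zMax zl i) (zγ i)

variable {G}

section Basic

variable {zl : ℕ → ℝ} {zγ : ℕ × ℕ → ℝ}

/-- Membership in `over`. [cite: Volkov2020, §2.1 (journal p.7)] -/
theorem mem_over {k : ℕ} {i : ℕ × ℕ} : i ∈ G.over k ↔ i ∈ G.ph ∧ k ∈ Finset.Ico i.1 i.2 := by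
  unfold over; rw [Finset.mem_filter]

/-- The lepton path of a photon lies inside the line set 0…N−1. [cite: Volkov2020, §2.1 (journal p.7)] -/
theorem Ico_subset_range {i : ℕ × ℕ} (hi : i ∈ G.ph) : Finset.Ico i.1 i.2 ⊆ range G.N := by
  intro k hk
  rw [Finset.mem_Ico] at hk
  exact Finset.mem_range.2 (lt_of_lt_of_le hk.2 (G.le_of_mem i hi))

/-- The lepton path of a photon is nonempty (u < v). [cite: Volkov2020, §2.1 (journal p.7)] -/
theorem Ico_nonempty {i : ℕ × ℕ} (hi : i ∈ G.ph) : (Finset.Ico i.1 i.2).Nonempty :=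
  ⟨i.1, Finset.mem_Ico.2 ⟨le_rfl, G.lt_of_mem i hi⟩⟩

/-- |LPath(i)| as a real number is the cardinality of `Ico u v`, and it is ≥ 1. [cite: Volkov2020, §2.1 (journal p.7)] -/
theorem nPath_eq_card {i : ℕ × ℕ} : nPath i = ((Finset.Ico i.1 i.2).card : ℝ) := by
  unfold nPath; rw [Nat.card_Ico]

/-- |LPath(i)| ≥ 1 for a photon of the skeleton. [cite: Volkov2020, §2.1 (journal p.7)] -/
theorem one_le_nPath {i : ℕ × ℕ} (hi : i ∈ G.ph) : (1 : ℝ) ≤ nPath i := by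
  rw [nPath_eq_card]
  exact_mod_cast Finset.card_pos.2 (Ico_nonempty hi)

/-- The dissipated power is ≥ 0. [cite: Volkov2020, §2.2.1 (journal p.9)] -/
theorem energy_nonneg (hzl : ∀ k, 0 < zl k) (hzγ : ∀ i, 0 < zγ i) (t : ℕ × ℕ → ℝ) : 0 ≤ G.energy zl zγ t := by
  unfold energy
  refine add_nonneg (Finset.sum_nonneg fun k _ => ?_) (Finset.sum_nonneg fun i _ => ?_)
  · exact mul_nonneg (hzl k).le (sq_nonneg _)
  · exact mul_nonneg (hzγ i).le (sq_nonneg _)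

/-- **Z ≤ the power of any unit flow** (Thomson; contains «Z(z) ≤ Z_i(z) ≤ Z₀(z)», Rayleigh). [cite: Grimmett2018, Ch. 1 Thm 1.28, Thm 1.29]
[cite: Volkov2020, proof of Lemma 3.4 «It is obvious that Z(z) ≤ Z_i(z) ≤ Z₀(z)» (journal p.12; tex l.376–379)] -/
theorem effRes_le_energy (hzl : ∀ k, 0 < zl k) (hzγ : ∀ i, 0 < zγ i) (t : ℕ × ℕ → ℝ) :
    G.effRes zl zγ ≤ G.energy zl zγ t :=
  ciInf_le ⟨0, by rintro _ ⟨s, rfl⟩; exact energy_nonneg hzl hzγ s⟩ t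

/-- A lower bound valid for every unit flow is a lower bound for Z. [cite: Volkov2020, eq. (2.4) (journal p.10)] -/
theorem le_effRes {b : ℝ} (h : ∀ t, b ≤ G.energy zl zγ t) : b ≤ G.effRes zl zγ :=
  le_ciInf h

/-- The flow through the lepton path alone (t = 0) dissipates Z₀. [cite: Volkov2020, eq. (2.4) «Z₀(z) = Σ_{l∈Lept(E(G))} z_l» (journal p.10)] -/
theorem energy_zero : G.energy zl zγ (fun _ => 0) = G.Z0 zl := by
  unfold energy lineCurrent Z0
  simp

/-- Z ≤ Z₀. [cite: Volkov2020, proof of Lemma 3.4 (journal p.12; tex l.376–379)] -/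
theorem effRes_le_Z0 (hzl : ∀ k, 0 < zl k) (hzγ : ∀ i, 0 < zγ i) : G.effRes zl zγ ≤ G.Z0 zl := by
  rw [← energy_zero (G := G) (zγ := zγ)]
  exact effRes_le_energy hzl hzγ _

/-- W ≤ 0: the on-shell denominator has constant sign, |W| = m²(Z₀ − Z).
[cite: Volkov2020, eq. (2.4) and §1 «the sign of W(z,p,0) … is constant inside the integration area» (journal p.4, p.10; tex l.104, l.261)] -/
theorem W_nonpos (hzl : ∀ k, 0 < zl k) (hzγ : ∀ i, 0 < zγ i) (m : ℝ) : G.W m zl zγ ≤ 0 := by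
  unfold W
  exact mul_nonpos_of_nonneg_of_nonpos (sq_nonneg m) (by linarith [effRes_le_Z0 (G := G) hzl hzγ])

/-- |W| = m²(Z₀ − Z). [cite: Volkov2020, proof of Lemma 3.4 «|W(z)| ≥ m²(Z₀(z) − Z_i(z))» (journal p.12; tex l.381)] -/
theorem abs_W (hzl : ∀ k, 0 < zl k) (hzγ : ∀ i, 0 < zγ i) (m : ℝ) :
    |G.W m zl zγ| = m ^ 2 * (G.Z0 zl - G.effRes zl zγ) := by
  rw [abs_of_nonpos (W_nonpos hzl hzγ m)]
  unfold W
  ring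

/-- 0 < z′_i ≤ z″_i for a photon of the skeleton (max ≤ sum of positive terms). [cite: Volkov2020, proof of Lemma 3.4 (journal p.12; tex l.389–392)] -/
theorem zMax_pos_le_zSum (hzl : ∀ k, 0 < zl k) {i : ℕ × ℕ} (hi : i ∈ G.ph) :
    0 < zMax zl i ∧ zMax zl i ≤ zSum zl i := by
  have hne := Ico_nonempty hi
  unfold zMax zSum
  rw [dif_pos hne]
  obtain ⟨k, hk, heq⟩ := Finset.exists_mem_eq_sup' hne zl
  rw [heq]
  exact ⟨hzl k, Finset.single_le_sum (f := zl) (fun j _ => (hzl j).le) hk⟩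

/-- z_l ≤ z′_i for l ∈ LPath(i). [cite: Volkov2020, Lemma 3.4 «z′_i = max_{l∈LPath(i)} z_l» (journal p.12)] -/
theorem le_zMax {i : ℕ × ℕ} {k : ℕ} (hk : k ∈ Finset.Ico i.1 i.2) : zl k ≤ zMax zl i := by
  unfold zMax
  rw [dif_pos ⟨k, hk⟩]
  exact Finset.le_sup' zl hk

end Basic

/-! ## The lower bound (the printed proof): the flow through one chord -/

section Lower

variable {zl : ℕ → ℝ} {zγ : ℕ × ℕ → ℝ}

/-- The flow that sends the current τ through the single chord i₀ (and 1 − τ under it). [cite: Volkov2020, proof of Lemma 3.4 «removing all photon lines except i» (journal p.12; tex l.374–375)] -/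
def singleChord (i₀ : ℕ × ℕ) (τ : ℝ) (i : ℕ × ℕ) : ℝ := if i = i₀ then τ else 0

/-- Its line currents: 1 − τ under the chord, 1 elsewhere. [cite: Volkov2020, proof of Lemma 3.4 (journal p.12)] -/
theorem lineCurrent_singleChord {i₀ : ℕ × ℕ} (hi₀ : i₀ ∈ G.ph) (τ : ℝ) (k : ℕ) :
    G.lineCurrent (singleChord i₀ τ) k = 1 - if k ∈ Finset.Ico i₀.1 i₀.2 then τ else 0 := by
  unfold lineCurrent singleChord
  rw [Finset.sum_ite_eq' (G.over k) i₀ (fun _ => τ)]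
  congr 1
  by_cases hk : k ∈ Finset.Ico i₀.1 i₀.2
  · rw [if_pos hk, if_pos (mem_over.2 ⟨hi₀, hk⟩)]
  · rw [if_neg hk, if_neg (fun h => hk (mem_over.1 h).2)]

/-- Its power: Z₀ − z″ + (1 − τ)²z″ + τ²z_{i₀} (series outside the chord's path, the split inside).
[cite: Volkov2020, proof of Lemma 3.4 (journal p.12; tex l.380–387)] -/
theorem energy_singleChord {i₀ : ℕ × ℕ} (hi₀ : i₀ ∈ G.ph) (τ : ℝ) :
    G.energy zl zγ (singleChord i₀ τ) = G.Z0 zl - zSum zl i₀ + (1 - τ) ^ 2 * zSum zl i₀ + τ ^ 2 * zγ i₀ := by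
  unfold energy Z0 zSum
  have h1 : ∑ k ∈ range G.N, zl k * G.lineCurrent (singleChord i₀ τ) k ^ 2 =
      ∑ k ∈ range G.N, (zl k + if k ∈ Finset.Ico i₀.1 i₀.2 then zl k * ((1 - τ) ^ 2 - 1) else 0) := by
    refine Finset.sum_congr rfl fun k _ => ?_
    rw [lineCurrent_singleChord hi₀]
    by_cases hk : k ∈ Finset.Ico i₀.1 i₀.2
    · rw [if_pos hk, if_pos hk]; ring
    · rw [if_neg hk, if_neg hk]; ring
  have h2 : ∑ i ∈ G.ph, zγ i * singleChord i₀ τ i ^ 2 = τ ^ 2 * zγ i₀ := by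
    rw [Finset.sum_eq_single i₀]
    · simp [singleChord]; ring
    · intro i _ hne
      simp [singleChord, hne]
    · intro h; exact absurd hi₀ h
  rw [h1, h2, Finset.sum_add_distrib, Finset.sum_ite_mem, Finset.inter_eq_right.2 (Ico_subset_range hi₀),
    ← Finset.sum_mul]
  ring

/-- **Z ≤ Z₀ − z″_i + z_i z″_i/(z_i + z″_i)** for every photon i: the one-chord flow with the optimal split τ = z″/(z_i + z″) — the content of
«Z ≤ Z_i» and «Z₀ − Z_i = z″ − z_i z″/(z_i + z″)» together. [cite: Volkov2020, proof of Lemma 3.4 (journal p.12; tex l.376–387)] -/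
theorem effRes_le_singleChord (hzl : ∀ k, 0 < zl k) (hzγ : ∀ i, 0 < zγ i) {i : ℕ × ℕ} (hi : i ∈ G.ph) :
    G.effRes zl zγ ≤ G.Z0 zl - zSum zl i + zγ i * zSum zl i / (zγ i + zSum zl i) := by
  have hS : 0 < zSum zl i := lt_of_lt_of_le (zMax_pos_le_zSum hzl hi).1 (zMax_pos_le_zSum hzl hi).2
  have hz : 0 < zγ i := hzγ i
  have hden : zγ i + zSum zl i ≠ 0 := by positivity
  have h := effRes_le_energy (G := G) hzl hzγ (singleChord i (zSum zl i / (zγ i + zSum zl i)))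
  rw [energy_singleChord hi] at h
  have key : (1 - zSum zl i / (zγ i + zSum zl i)) ^ 2 * zSum zl i + (zSum zl i / (zγ i + zSum zl i)) ^ 2 * zγ i =
      zγ i * zSum zl i / (zγ i + zSum zl i) := by
    field_simp
    ring
  linarith [key]

/-- **Lemma 3.4 per photon, explicit constant**: (m²/2)·(z′_i)²/max(z′_i, z_i) ≤ |W(z)| for EVERY photon i.
[cite: Volkov2020, Lemma 3.4 eq. (3.3) and its proof (journal p.12; tex l.362–393)] -/
theorem lemma34_lower (hzl : ∀ k, 0 < zl k) (hzγ : ∀ i, 0 < zγ i) (m : ℝ) {i : ℕ × ℕ} (hi : i ∈ G.ph) :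
    m ^ 2 / 2 * f33 zl zγ i ≤ |G.W m zl zγ| := by
  unfold f33 W
  have h01 := zMax_pos_le_zSum (G := G) hzl hi
  exact lemma34_printed_form m (G.effRes zl zγ) (G.Z0 zl) (zγ i) (zMax zl i) (zSum zl i) (hzγ i).le h01.1 h01.2
    (effRes_le_singleChord hzl hzγ hi)

/-- **Lemma 3.4 AS PRINTED** (with C = m²/2): (m²/2)·max_{i∈Ph(E(G))} (z′_i)²/max(z′_i, z_i) ≤ |W(z)|.
[cite: Volkov2020, Lemma 3.4 eq. (3.3) (journal p.12; tex l.362–372)] -/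
theorem lemma34 (hzl : ∀ k, 0 < zl k) (hzγ : ∀ i, 0 < zγ i) (m : ℝ) (hne : G.ph.Nonempty) :
    m ^ 2 / 2 * G.ph.sup' hne (f33 zl zγ) ≤ |G.W m zl zγ| := by
  obtain ⟨i, hi, heq⟩ := Finset.exists_mem_eq_sup' hne (f33 zl zγ)
  rw [heq]
  exact lemma34_lower hzl hzγ m hi

end Lower

/-! ## The upper bound (footnote 23): a Nash-Williams cut bound -/

section Upper

variable {zl : ℕ → ℝ} {zγ : ℕ × ℕ → ℝ}

/-- The conductance of the cut at lepton line k, chords shared equally among the |LPath(i)| cuts they bridge: 1/z_k + Σ_{i over k} |LPath(i)|/z_i.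
[cite: LyonsPeres2016, §2.5 (2.13)] [cite: Volkov2020, fn 23 (journal p.12; tex l.363)] -/
noncomputable def cutCond (G : PathSkeleton) (zγ : ℕ × ℕ → ℝ) (k : ℕ) : ℝ := ∑ i ∈ G.over k, nPath i / zγ i

/-- Sedrakyan's two-term inequality: (a + b)²/(p + q) ≤ a²/p + b²/q for p, q > 0. [folklore] -/
private theorem two_block {a b p q : ℝ} (hp : 0 < p) (hq : 0 < q) : (a + b) ^ 2 / (p + q) ≤ a ^ 2 / p + b ^ 2 / q := by
  rw [div_add_div _ _ hp.ne' hq.ne', div_le_div_iff₀ (by positivity) (by positivity)]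
  nlinarith [sq_nonneg (a * q - b * p), mul_pos hp hq, mul_pos (mul_pos hp hq) hp, mul_pos (mul_pos hp hq) hq]

/-- **The cut bound per lepton line**: z_k·(current through k)² + Σ_{i over k} (z_i/|LPath(i)|)·t_i² ≥ (1/z_k + Σ_{i over k} |LPath(i)|/z_i)⁻¹ —
the currents through the cut add up to 1; Cauchy–Schwarz («Σ i(e)²r(e)·Σ c(e) ≥ (Σ|i(e)|)² ≥ 1»). [cite: LyonsPeres2016, §2.5 proof of (2.13)] [cite: Volkov2020, fn 23 (journal p.12; tex l.363)] -/
theorem cut_bound (hzl : ∀ k, 0 < zl k) (hzγ : ∀ i, 0 < zγ i) (t : ℕ × ℕ → ℝ) (k : ℕ) :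
    (1 / zl k + G.cutCond zγ k)⁻¹ ≤
      zl k * G.lineCurrent t k ^ 2 + ∑ i ∈ G.over k, zγ i / nPath i * t i ^ 2 := by
  have hz : 0 < zl k := hzl k
  have hn : ∀ i ∈ G.over k, 0 < nPath i := fun i hi =>
    lt_of_lt_of_le zero_lt_one (one_le_nPath (mem_over.1 hi).1)
  have hS0 : 0 ≤ G.cutCond zγ k := Finset.sum_nonneg fun i hi => (div_pos (hn i hi) (hzγ i)).le
  -- the line term alone: z a² = a²/(1/z)
  have hline : zl k * G.lineCurrent t k ^ 2 = G.lineCurrent t k ^ 2 / (1 / zl k) := by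
    field_simp
  by_cases hemp : G.over k = ∅
  · -- no chord over k: the current through k is 1
    have hcur : G.lineCurrent t k = 1 := by unfold lineCurrent; rw [hemp, Finset.sum_empty, sub_zero]
    unfold cutCond
    rw [hemp, Finset.sum_empty, Finset.sum_empty, add_zero, add_zero, hcur, one_pow, mul_one, one_div, inv_inv]
  · have hne : (G.over k).Nonempty := Finset.nonempty_iff_ne_empty.2 hemp
    have hS : 0 < G.cutCond zγ k := Finset.sum_pos (fun i hi => div_pos (hn i hi) (hzγ i)) hne
    -- Sedrakyan over the chords: (Σ t_i)²/S ≤ Σ t_i²/(n_i/z_i)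
    have hch : (∑ i ∈ G.over k, t i) ^ 2 / G.cutCond zγ k ≤ ∑ i ∈ G.over k, zγ i / nPath i * t i ^ 2 := by
      unfold cutCond
      refine (Finset.sq_sum_div_le_sum_sq_div (G.over k) t fun i hi => div_pos (hn i hi) (hzγ i)).trans (le_of_eq ?_)
      refine Finset.sum_congr rfl fun i hi => ?_
      have := (hn i hi).ne'
      have := (hzγ i).ne'
      field_simp
    -- combine the two blocks: a + Σ t = 1
    have hsum : G.lineCurrent t k + ∑ i ∈ G.over k, t i = 1 := by unfold lineCurrent; ring
    have h2 := two_block (a := G.lineCurrent t k) (b := ∑ i ∈ G.over k, t i) (one_div_pos.2 hz) hS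
    rw [hsum, one_pow, one_div (1 / zl k + _)] at h2
    rw [hline]
    linarith

/-- Summing the chord shares over the cuts they bridge returns each chord's full power: Σ_k Σ_{i over k} (z_i/|LPath(i)|) t_i² = Σ_i z_i t_i².
[cite: Volkov2020, §2.1 «LPath(i)» (journal p.7; tex l.166–170)] -/
theorem sum_chordShares (t : ℕ × ℕ → ℝ) :
    ∑ k ∈ range G.N, ∑ i ∈ G.over k, zγ i / nPath i * t i ^ 2 = ∑ i ∈ G.ph, zγ i * t i ^ 2 := by
  have h1 : ∀ k ∈ range G.N, ∑ i ∈ G.over k, zγ i / nPath i * t i ^ 2 =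
      ∑ i ∈ G.ph, if k ∈ Finset.Ico i.1 i.2 then zγ i / nPath i * t i ^ 2 else 0 := fun k _ => by
    unfold over
    rw [Finset.sum_filter]
  rw [Finset.sum_congr rfl h1, Finset.sum_comm]
  refine Finset.sum_congr rfl fun i hi => ?_
  rw [Finset.sum_ite_mem, Finset.inter_eq_right.2 (Ico_subset_range hi), Finset.sum_const, nsmul_eq_mul, ← nPath_eq_card]
  have hn : nPath i ≠ 0 := (lt_of_lt_of_le zero_lt_one (one_le_nPath hi)).ne'
  field_simp

/-- **Every unit flow dissipates at least Σ_k (1/z_k + Σ_{i over k} |LPath(i)|/z_i)⁻¹** (Nash-Williams with each chord i subdivided into |LPath(i)|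
equal pieces, one per cut it bridges). [cite: LyonsPeres2016, §2.5 «The Nash-Williams Inequality» (2.13)] [cite: Volkov2020, fn 23 (journal p.12; tex l.363)] -/
theorem energy_ge_cutBound (hzl : ∀ k, 0 < zl k) (hzγ : ∀ i, 0 < zγ i) (t : ℕ × ℕ → ℝ) :
    ∑ k ∈ range G.N, (1 / zl k + G.cutCond zγ k)⁻¹ ≤ G.energy zl zγ t := by
  unfold energy
  rw [← sum_chordShares (G := G) t, ← Finset.sum_add_distrib]
  exact Finset.sum_le_sum fun k _ => cut_bound hzl hzγ t k

/-- Hence Z ≥ Σ_k (1/z_k + Σ_{i over k} |LPath(i)|/z_i)⁻¹. [cite: LyonsPeres2016, §2.5 (2.13)] [cite: Volkov2020, fn 23 (journal p.12)] -/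
theorem cutBound_le_effRes (hzl : ∀ k, 0 < zl k) (hzγ : ∀ i, 0 < zγ i) :
    ∑ k ∈ range G.N, (1 / zl k + G.cutCond zγ k)⁻¹ ≤ G.effRes zl zγ :=
  le_effRes fun t => energy_ge_cutBound hzl hzγ t

/-- The drop of one cut: z − (1/z + S)⁻¹ = z²S/(1 + zS) ≤ min(z, z²S) ≤ Σ_{i over k} min(z_k, |LPath(i)|·z_k²/z_i).
[cite: Volkov2020, fn 23 (journal p.12; tex l.363)] -/
theorem cut_drop_le (hzl : ∀ k, 0 < zl k) (hzγ : ∀ i, 0 < zγ i) (k : ℕ) :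
    zl k - (1 / zl k + G.cutCond zγ k)⁻¹ ≤ ∑ i ∈ G.over k, min (zl k) (nPath i * zl k ^ 2 / zγ i) := by
  have hz : 0 < zl k := hzl k
  have hn : ∀ i ∈ G.over k, 0 < nPath i := fun i hi =>
    lt_of_lt_of_le zero_lt_one (one_le_nPath (mem_over.1 hi).1)
  have hterm : ∀ i ∈ G.over k, 0 ≤ nPath i * zl k ^ 2 / zγ i := fun i hi => by
    have := hn i hi; have := hzγ i; positivity
  have hS0 : 0 ≤ G.cutCond zγ k := Finset.sum_nonneg fun i hi => (div_pos (hn i hi) (hzγ i)).le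
  set S := G.cutCond zγ k with hSdef
  -- the drop in closed form
  have hdrop : zl k - (1 / zl k + S)⁻¹ = zl k ^ 2 * S / (1 + zl k * S) := by
    have h1 : 1 + zl k * S ≠ 0 := by positivity
    have h2 : 1 / zl k + S ≠ 0 := by positivity
    field_simp
    ring
  rw [hdrop]
  have hle_z : zl k ^ 2 * S / (1 + zl k * S) ≤ zl k := by
    rw [div_le_iff₀ (by positivity)]; nlinarith [hz, hS0]
  have hle_zS : zl k ^ 2 * S / (1 + zl k * S) ≤ zl k ^ 2 * S := by
    apply div_le_self (by positivity); nlinarith [hz, hS0]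
  -- z²S = Σ_i n_i z²/z_i
  have hzS : zl k ^ 2 * S = ∑ i ∈ G.over k, nPath i * zl k ^ 2 / zγ i := by
    rw [hSdef]; unfold cutCond; rw [Finset.mul_sum]
    refine Finset.sum_congr rfl fun i _ => ?_
    ring
  by_cases hbig : ∃ i ∈ G.over k, zl k ≤ nPath i * zl k ^ 2 / zγ i
  · -- some chord term alone is ≥ z_k: the sum of mins is ≥ z_k ≥ the drop
    obtain ⟨i, hi, hzi⟩ := hbig
    refine hle_z.trans ?_
    calc zl k = min (zl k) (nPath i * zl k ^ 2 / zγ i) := (min_eq_left hzi).symm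
      _ ≤ ∑ j ∈ G.over k, min (zl k) (nPath j * zl k ^ 2 / zγ j) :=
        Finset.single_le_sum (f := fun j => min (zl k) (nPath j * zl k ^ 2 / zγ j))
          (fun j hj => le_min hz.le (hterm j hj)) hi
  · -- every min is the chord term: the sum of mins is z²S ≥ the drop
    refine hle_zS.trans (le_of_eq ?_)
    rw [hzS]
    refine Finset.sum_congr rfl fun i hi => ?_
    rw [min_eq_right]
    exact le_of_lt (lt_of_not_ge fun h => hbig ⟨i, hi, h⟩)

/-- Per photon and per lepton line under it: min(z_k, |LPath(i)|·z_k²/z_i) ≤ |LPath(i)|·(z′_i)²/max(z′_i, z_i).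
[cite: Volkov2020, Lemma 3.4 eq. (3.3) (journal p.12; tex l.364–368)] -/
theorem min_le_nPath_mul_f33 (hzl : ∀ k, 0 < zl k) (hzγ : ∀ i, 0 < zγ i) {i : ℕ × ℕ} (hi : i ∈ G.ph) {k : ℕ}
    (hk : k ∈ Finset.Ico i.1 i.2) : min (zl k) (nPath i * zl k ^ 2 / zγ i) ≤ nPath i * f33 zl zγ i := by
  unfold f33
  have hz : 0 < zl k := hzl k
  have hc : 0 < zγ i := hzγ i
  have hn : 1 ≤ nPath i := one_le_nPath hi
  have hkm : zl k ≤ zMax zl i := le_zMax hk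
  have hm : 0 < zMax zl i := lt_of_lt_of_le hz hkm
  by_cases hcase : zMax zl i ≤ zγ i
  · -- max = z_i: compare the chord terms
    rw [max_eq_right hcase]
    refine (min_le_right _ _).trans ?_
    rw [mul_div_assoc]
    refine mul_le_mul_of_nonneg_left ?_ (by linarith)
    exact div_le_div_of_nonneg_right (by nlinarith [hkm, hz]) hc.le
  · -- max = z′_i: compare with z_k ≤ z′_i ≤ n·z′_i
    rw [max_eq_left (le_of_lt (lt_of_not_ge hcase))]
    refine (min_le_left _ _).trans ?_
    have : zMax zl i ^ 2 / zMax zl i = zMax zl i := by field_simp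
    rw [this]
    nlinarith [hkm, hn, hm]

/-- **Z₀ − Z ≤ Σ_{i∈Ph(E(G))} |LPath(i)|²·(z′_i)²/max(z′_i, z_i)** — the converse direction of (3.3) announced in footnote 23, with an explicit
graph constant. [cite: Volkov2020, Lemma 3.4 fn 23 «This inequality works in both directions too» (journal p.12; tex l.363)] -/
theorem Z0_sub_effRes_le (hzl : ∀ k, 0 < zl k) (hzγ : ∀ i, 0 < zγ i) :
    G.Z0 zl - G.effRes zl zγ ≤ ∑ i ∈ G.ph, nPath i ^ 2 * f33 zl zγ i := by
  -- Z₀ − Z ≤ Σ_k (z_k − cut_k⁻¹)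
  have h1 : G.Z0 zl - G.effRes zl zγ ≤ ∑ k ∈ range G.N, (zl k - (1 / zl k + G.cutCond zγ k)⁻¹) := by
    rw [Finset.sum_sub_distrib]
    unfold Z0
    linarith [cutBound_le_effRes (G := G) hzl hzγ]
  -- ≤ Σ_k Σ_{i over k} min(…) = Σ_i Σ_{k ∈ LPath(i)} min(…)
  have h2 : ∑ k ∈ range G.N, (zl k - (1 / zl k + G.cutCond zγ k)⁻¹) ≤
      ∑ k ∈ range G.N, ∑ i ∈ G.over k, min (zl k) (nPath i * zl k ^ 2 / zγ i) :=
    Finset.sum_le_sum fun k _ => cut_drop_le hzl hzγ k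
  have h3 : ∑ k ∈ range G.N, ∑ i ∈ G.over k, min (zl k) (nPath i * zl k ^ 2 / zγ i) =
      ∑ i ∈ G.ph, ∑ k ∈ Finset.Ico i.1 i.2, min (zl k) (nPath i * zl k ^ 2 / zγ i) := by
    have e1 : ∀ k ∈ range G.N, ∑ i ∈ G.over k, min (zl k) (nPath i * zl k ^ 2 / zγ i) =
        ∑ i ∈ G.ph, if k ∈ Finset.Ico i.1 i.2 then min (zl k) (nPath i * zl k ^ 2 / zγ i) else 0 := fun k _ => by
      unfold over; rw [Finset.sum_filter]
    rw [Finset.sum_congr rfl e1, Finset.sum_comm]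
    refine Finset.sum_congr rfl fun i hi => ?_
    rw [Finset.sum_ite_mem, Finset.inter_eq_right.2 (Ico_subset_range hi)]
  -- each inner sum ≤ |LPath(i)|·(|LPath(i)|·f_i)
  have h4 : ∀ i ∈ G.ph, ∑ k ∈ Finset.Ico i.1 i.2, min (zl k) (nPath i * zl k ^ 2 / zγ i) ≤ nPath i ^ 2 * f33 zl zγ i :=
    fun i hi => by
      refine (Finset.sum_le_sum fun k hk => min_le_nPath_mul_f33 hzl hzγ hi hk).trans (le_of_eq ?_)
      rw [Finset.sum_const, nsmul_eq_mul, ← nPath_eq_card]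
      ring
  calc G.Z0 zl - G.effRes zl zγ ≤ _ := h1
    _ ≤ _ := h2
    _ = _ := h3
    _ ≤ ∑ i ∈ G.ph, nPath i ^ 2 * f33 zl zγ i := Finset.sum_le_sum h4

/-- **Footnote 23 PROVED — the upper direction of (3.3)**: |W(z)| ≤ m²·Σ_{i∈Ph(E(G))} |LPath(i)|²·(z′_i)²/max(z′_i, z_i).
[cite: Volkov2020, Lemma 3.4 fn 23 (journal p.12; tex l.363)] -/
theorem lemma34_upper (hzl : ∀ k, 0 < zl k) (hzγ : ∀ i, 0 < zγ i) (m : ℝ) :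
    |G.W m zl zγ| ≤ m ^ 2 * ∑ i ∈ G.ph, nPath i ^ 2 * f33 zl zγ i := by
  rw [abs_W hzl hzγ m]
  exact mul_le_mul_of_nonneg_left (Z0_sub_effRes_le hzl hzγ) (sq_nonneg m)

/-- **(3.3) IS TWO-SIDED** with constants depending only on the structure of the graph (and m):
(m²/2)·max_i (z′_i)²/max(z′_i, z_i) ≤ |W(z)| ≤ m²·(Σ_i |LPath(i)|²)·max_i (z′_i)²/max(z′_i, z_i).
[cite: Volkov2020, Lemma 3.4 eq. (3.3) with fn 23 (journal p.12; tex l.362–372)] -/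
theorem lemma34_two_sided (hzl : ∀ k, 0 < zl k) (hzγ : ∀ i, 0 < zγ i) (m : ℝ) (hne : G.ph.Nonempty) :
    m ^ 2 / 2 * G.ph.sup' hne (f33 zl zγ) ≤ |G.W m zl zγ| ∧
      |G.W m zl zγ| ≤ m ^ 2 * (∑ i ∈ G.ph, nPath i ^ 2) * G.ph.sup' hne (f33 zl zγ) := by
  refine ⟨lemma34 hzl hzγ m hne, (lemma34_upper hzl hzγ m).trans ?_⟩
  rw [mul_assoc, Finset.sum_mul]
  refine mul_le_mul_of_nonneg_left (Finset.sum_le_sum fun i hi => ?_) (sq_nonneg m)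
  exact mul_le_mul_of_nonneg_left (Finset.le_sup' (f33 zl zγ) hi) (sq_nonneg _)

end Upper

/-! ## Non-vacuity: the one-loop vertex graph -/

section OneLoop

/-- On the one-loop vertex graph (`oneLoop`: lepton lines 0, 1 of resistances z₀, z₁, the photon (0, 2) of resistance z_γ over both) the two
bounds read (m²/2)·(z′)²/max(z′, z_γ) ≤ |W| ≤ 4m²·(z′)²/max(z′, z_γ) with z′ = max(z₀, z₁) — here Z₀ − Z = (z₀+z₁)²/(z₀+z₁+z_γ) exactly.
[cite: Volkov2020, Lemma 3.4 eq. (3.3) with fn 23 (journal p.12)] -/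
theorem oneLoop_lemma34 (zl : ℕ → ℝ) (zγ : ℕ × ℕ → ℝ) (hzl : ∀ k, 0 < zl k) (hzγ : ∀ i, 0 < zγ i) (m : ℝ) :
    m ^ 2 / 2 * f33 zl zγ (0, 2) ≤ |oneLoop.W m zl zγ| ∧ |oneLoop.W m zl zγ| ≤ m ^ 2 * (4 * f33 zl zγ (0, 2)) := by
  have hph : oneLoop.ph = {(0, 2)} := rfl
  refine ⟨lemma34_lower hzl hzγ m (by rw [hph]; exact Finset.mem_singleton_self _), ?_⟩
  have h := lemma34_upper (G := oneLoop) hzl hzγ m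
  rw [hph, Finset.sum_singleton] at h
  have hn : nPath (0, 2) = 2 := by unfold nPath; norm_num
  rw [hn] at h
  linarith

end OneLoop

/-! ## Thomson's principle on this circuit: the Kirchhoff current distribution attains the infimum, and Z is its voltage drop -/

section Thomson

variable {zl : ℕ → ℝ} {zγ : ℕ × ℕ → ℝ}

/-- **Kirchhoff's voltage law** for the chord currents t (the current law holds identically by `lineCurrent`): across every photon i = (u, v) the
voltage z_i·t_i equals the voltage Σ_{k∈LPath(i)} z_k·i_k along the lepton path under it — i.e. t is the physical current distribution of the
circuit with unit external current. [cite: Volkov2020, §2.2.1 «electric circuit analogy … external currents» (journal p.9; tex l.237)]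
[cite: Grimmett2018, Ch. 1 Lemma 1.25] -/
def KVL (G : PathSkeleton) (zl : ℕ → ℝ) (zγ : ℕ × ℕ → ℝ) (t : ℕ × ℕ → ℝ) : Prop :=
  ∀ i ∈ G.ph, zγ i * t i = ∑ k ∈ Finset.Ico i.1 i.2, zl k * G.lineCurrent t k

/-- Exchanging the two sums: Σ_k g_k·Σ_{i over k} b_i = Σ_{i∈Ph} b_i·Σ_{k∈LPath(i)} g_k. [cite: Volkov2020, §2.1 «LPath(i)» (journal p.7)] -/
theorem sum_over_swap (g : ℕ → ℝ) (b : ℕ × ℕ → ℝ) :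
    ∑ k ∈ range G.N, g k * ∑ i ∈ G.over k, b i = ∑ i ∈ G.ph, b i * ∑ k ∈ Finset.Ico i.1 i.2, g k := by
  have h1 : ∀ k ∈ range G.N, g k * ∑ i ∈ G.over k, b i = ∑ i ∈ G.ph, if k ∈ Finset.Ico i.1 i.2 then g k * b i else 0 :=
    fun k _ => by
      unfold over
      rw [Finset.mul_sum, Finset.sum_filter]
  rw [Finset.sum_congr rfl h1, Finset.sum_comm]
  refine Finset.sum_congr rfl fun i hi => ?_
  rw [Finset.sum_ite_mem, Finset.inter_eq_right.2 (Ico_subset_range hi), Finset.mul_sum]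
  exact Finset.sum_congr rfl fun k _ => by ring

/-- **Thomson's principle, the inequality**: if t⋆ obeys Kirchhoff's voltage law then every unit flow t dissipates
energy(t) = energy(t⋆) + Σ_k z_k(i_k − i⋆_k)² + Σ_i z_i(t_i − t⋆_i)² ≥ energy(t⋆) (the cross term vanishes because t − t⋆ is a sum of chord
cycles). [cite: Grimmett2018, Ch. 1 Thm 1.28 (Thomson principle) and its proof] [cite: LyonsPeres2016, §2.4 «Thomson's Principle»] -/
theorem energy_eq_of_KVL {t₀ : ℕ × ℕ → ℝ} (h : G.KVL zl zγ t₀) (t : ℕ × ℕ → ℝ) :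
    G.energy zl zγ t = G.energy zl zγ t₀ +
      (∑ k ∈ range G.N, zl k * (G.lineCurrent t k - G.lineCurrent t₀ k) ^ 2 + ∑ i ∈ G.ph, zγ i * (t i - t₀ i) ^ 2) := by
  -- the cross term: Σ_k z_k i⋆_k (i_k − i⋆_k) = −Σ_i z_i t⋆_i (t_i − t⋆_i)
  have hdiff : ∀ k, G.lineCurrent t k - G.lineCurrent t₀ k = -∑ i ∈ G.over k, (t i - t₀ i) := fun k => by
    unfold lineCurrent; rw [Finset.sum_sub_distrib]; ring
  have hcross : ∑ k ∈ range G.N, zl k * G.lineCurrent t₀ k * (G.lineCurrent t k - G.lineCurrent t₀ k) =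
      -∑ i ∈ G.ph, zγ i * t₀ i * (t i - t₀ i) := by
    have e1 : ∑ k ∈ range G.N, zl k * G.lineCurrent t₀ k * (G.lineCurrent t k - G.lineCurrent t₀ k) =
        -∑ k ∈ range G.N, (zl k * G.lineCurrent t₀ k) * ∑ i ∈ G.over k, (t i - t₀ i) := by
      rw [← Finset.sum_neg_distrib]
      exact Finset.sum_congr rfl fun k _ => by rw [hdiff k]; ring
    rw [e1, sum_over_swap]
    congr 1
    refine Finset.sum_congr rfl fun i hi => ?_
    rw [← h i hi]
    ring
  -- expand both energies
  unfold energy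
  have ek : ∀ k ∈ range G.N, zl k * G.lineCurrent t k ^ 2 = zl k * G.lineCurrent t₀ k ^ 2 +
      (2 * (zl k * G.lineCurrent t₀ k * (G.lineCurrent t k - G.lineCurrent t₀ k)) +
        zl k * (G.lineCurrent t k - G.lineCurrent t₀ k) ^ 2) := fun k _ => by ring
  have ei : ∀ i ∈ G.ph, zγ i * t i ^ 2 = zγ i * t₀ i ^ 2 + (2 * (zγ i * t₀ i * (t i - t₀ i)) + zγ i * (t i - t₀ i) ^ 2) :=
    fun i _ => by ring
  rw [Finset.sum_congr rfl ek, Finset.sum_congr rfl ei, Finset.sum_add_distrib, Finset.sum_add_distrib, Finset.sum_add_distrib,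
    Finset.sum_add_distrib, ← Finset.mul_sum, ← Finset.mul_sum, hcross]
  ring

/-- **Thomson's principle on the lepton-path circuit**: a current distribution obeying Kirchhoff's laws dissipates exactly Z = `effRes` (it attains
the infimum). [cite: Grimmett2018, Ch. 1 Thm 1.28] [cite: LyonsPeres2016, §2.4] [cite: Volkov2020, eq. (2.4) (journal p.10)] -/
theorem effRes_eq_energy_of_KVL (hzl : ∀ k, 0 < zl k) (hzγ : ∀ i, 0 < zγ i) {t₀ : ℕ × ℕ → ℝ} (h : G.KVL zl zγ t₀) :
    G.effRes zl zγ = G.energy zl zγ t₀ := by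
  refine le_antisymm (effRes_le_energy hzl hzγ t₀) (le_effRes fun t => ?_)
  rw [energy_eq_of_KVL h t]
  have h1 : 0 ≤ ∑ k ∈ range G.N, zl k * (G.lineCurrent t k - G.lineCurrent t₀ k) ^ 2 :=
    Finset.sum_nonneg fun k _ => mul_nonneg (hzl k).le (sq_nonneg _)
  have h2 : 0 ≤ ∑ i ∈ G.ph, zγ i * (t i - t₀ i) ^ 2 := Finset.sum_nonneg fun i _ => mul_nonneg (hzγ i).le (sq_nonneg _)
  linarith

/-- **Z is the voltage drop between the external vertices at unit current**: for the Kirchhoff distribution the dissipated power equals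
Σ_k z_k·i_k = (potential at vertex 0) − (potential at vertex N), i.e. «the resistance between the vertexes that are incident to the external
lepton lines» by Ohm's law — the identification of the Thomson form with eq. (2.4)'s Z, given the physical currents.
[cite: Grimmett2018, Ch. 1 Lemma 1.25] [cite: Volkov2020, eq. (2.4) (journal p.10; tex l.261–264)] -/
theorem effRes_eq_voltage_of_KVL (hzl : ∀ k, 0 < zl k) (hzγ : ∀ i, 0 < zγ i) {t₀ : ℕ × ℕ → ℝ} (h : G.KVL zl zγ t₀) :
    G.effRes zl zγ = ∑ k ∈ range G.N, zl k * G.lineCurrent t₀ k := by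
  rw [effRes_eq_energy_of_KVL hzl hzγ h]
  unfold energy
  -- Σ_i z_i t⋆_i² = Σ_i t⋆_i·Σ_{k∈LPath(i)} z_k i⋆_k = Σ_k z_k i⋆_k·Σ_{i over k} t⋆_i = Σ_k z_k i⋆_k (1 − i⋆_k)
  have hch : ∑ i ∈ G.ph, zγ i * t₀ i ^ 2 = ∑ k ∈ range G.N, zl k * G.lineCurrent t₀ k * (1 - G.lineCurrent t₀ k) := by
    have e1 : ∑ i ∈ G.ph, zγ i * t₀ i ^ 2 = ∑ i ∈ G.ph, t₀ i * ∑ k ∈ Finset.Ico i.1 i.2, (zl k * G.lineCurrent t₀ k) :=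
      Finset.sum_congr rfl fun i hi => by rw [← h i hi]; ring
    have e2 : ∀ k ∈ range G.N, zl k * G.lineCurrent t₀ k * (1 - G.lineCurrent t₀ k) =
        (zl k * G.lineCurrent t₀ k) * ∑ i ∈ G.over k, t₀ i := fun k _ => by unfold lineCurrent; ring
    rw [e1, Finset.sum_congr rfl e2, sum_over_swap]
  rw [hch, ← Finset.sum_add_distrib]
  exact Finset.sum_congr rfl fun k _ => by ring

end Thomson

/-! ## Existence of the Kirchhoff current distribution: the infimum is attained, and a minimiser obeys the voltage law -/

section Existence

variable {zl : ℕ → ℝ} {zγ : ℕ × ℕ → ℝ}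

/-- The power depends only on the currents through actual photons. [cite: Volkov2020, §2.2.1 (journal p.9)] -/
theorem energy_congr {t t' : ℕ × ℕ → ℝ} (h : ∀ i ∈ G.ph, t i = t' i) : G.energy zl zγ t = G.energy zl zγ t' := by
  unfold energy lineCurrent
  have hk : ∀ k, ∑ i ∈ G.over k, t i = ∑ i ∈ G.over k, t' i := fun k =>
    Finset.sum_congr rfl fun i hi => h i (mem_over.1 hi).1
  rw [Finset.sum_congr rfl fun k _ => by rw [hk k]]
  exact congrArg _ (Finset.sum_congr rfl fun i hi => by rw [h i hi])

/-- The power is a continuous function of the chord currents (product topology). [cite: Grimmett2018, Ch. 1 Thm 1.28] -/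
theorem continuous_energy : Continuous (G.energy zl zγ) := by
  unfold energy lineCurrent over
  fun_prop

/-- Each photon's own dissipation is at most the total power. [cite: Volkov2020, §2.2.1 (journal p.9)] -/
theorem chord_sq_le_energy (hzl : ∀ k, 0 < zl k) (hzγ : ∀ i, 0 < zγ i) (t : ℕ × ℕ → ℝ) {i : ℕ × ℕ} (hi : i ∈ G.ph) :
    zγ i * t i ^ 2 ≤ G.energy zl zγ t := by
  unfold energy
  have h1 : 0 ≤ ∑ k ∈ range G.N, zl k * G.lineCurrent t k ^ 2 :=
    Finset.sum_nonneg fun k _ => mul_nonneg (hzl k).le (sq_nonneg _)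
  have h2 : zγ i * t i ^ 2 ≤ ∑ j ∈ G.ph, zγ j * t j ^ 2 :=
    Finset.single_le_sum (f := fun j => zγ j * t j ^ 2) (fun j _ => mul_nonneg (hzγ j).le (sq_nonneg _)) hi
  linarith

/-- Z₀ ≥ 0. [cite: Volkov2020, eq. (2.4) (journal p.10)] -/
theorem Z0_nonneg (hzl : ∀ k, 0 < zl k) : 0 ≤ G.Z0 zl := Finset.sum_nonneg fun k _ => (hzl k).le

/-- **The infimum is attained**: some current distribution t⋆ minimises the power over all unit flows (continuity on the compact box
|t_i| ≤ Z₀/z_i + 1, outside of which a single chord already dissipates more than the path flow's Z₀).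
[cite: Grimmett2018, Ch. 1 Thm 1.28 (Thomson principle)] -/
theorem exists_isMin (hzl : ∀ k, 0 < zl k) (hzγ : ∀ i, 0 < zγ i) :
    ∃ t₀ : ℕ × ℕ → ℝ, ∀ t, G.energy zl zγ t₀ ≤ G.energy zl zγ t := by
  classical
  set S : Set (ℕ × ℕ → ℝ) :=
    Set.pi Set.univ fun i => if i ∈ G.ph then Set.Icc (-(G.Z0 zl / zγ i + 1)) (G.Z0 zl / zγ i + 1) else {0} with hSdef
  have hS : IsCompact S := isCompact_univ_pi fun i => by
    by_cases hi : i ∈ G.ph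
    · rw [if_pos hi]; exact isCompact_Icc
    · rw [if_neg hi]; exact isCompact_singleton
  have hR : ∀ i, 0 ≤ G.Z0 zl / zγ i + 1 := fun i => by
    have := div_nonneg (Z0_nonneg (G := G) hzl) (hzγ i).le; linarith
  have h0S : (fun _ : ℕ × ℕ => (0 : ℝ)) ∈ S := by
    rw [hSdef, Set.mem_univ_pi]
    intro i
    by_cases hi : i ∈ G.ph
    · rw [if_pos hi, Set.mem_Icc]; exact ⟨by linarith [hR i], hR i⟩
    · rw [if_neg hi]; exact Set.mem_singleton _
  obtain ⟨t₀, -, hmin⟩ := hS.exists_isMinOn ⟨_, h0S⟩ continuous_energy.continuousOn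
  refine ⟨t₀, fun t => ?_⟩
  -- truncate t outside the photons; the power is unchanged
  set t' : ℕ × ℕ → ℝ := fun i => if i ∈ G.ph then t i else 0 with ht'def
  have ht' : G.energy zl zγ t = G.energy zl zγ t' := energy_congr fun i hi => by rw [ht'def]; simp only [if_pos hi]
  rw [ht']
  by_cases hin : t' ∈ S
  · exact hmin hin
  · -- some photon current is large: that chord alone dissipates more than Z₀ ≥ energy t₀
    have hex : ∃ i ∈ G.ph, G.Z0 zl / zγ i + 1 < |t i| := by
      by_contra hno
      apply hin
      rw [hSdef, Set.mem_univ_pi]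
      intro i
      by_cases hi : i ∈ G.ph
      · rw [if_pos hi, ht'def]
        simp only [if_pos hi]
        rw [Set.mem_Icc, ← abs_le]
        exact le_of_not_gt fun h => hno ⟨i, hi, h⟩
      · rw [if_neg hi, ht'def]
        simp only [if_neg hi]
        exact Set.mem_singleton _
    obtain ⟨i, hi, hbig⟩ := hex
    have h1 : 1 ≤ |t i| := le_trans (by linarith [hR i, div_nonneg (Z0_nonneg (G := G) hzl) (hzγ i).le]) hbig.le
    have hsq : |t i| ≤ t i ^ 2 := by rw [← sq_abs]; nlinarith [h1]
    have hE : G.Z0 zl < G.energy zl zγ t' := by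
      have hc := chord_sq_le_energy hzl hzγ t' hi
      have hti : t' i = t i := by rw [ht'def]; simp only [if_pos hi]
      rw [hti] at hc
      have hz := hzγ i
      have e : zγ i * (G.Z0 zl / zγ i + 1) = G.Z0 zl + zγ i := by field_simp
      have : zγ i * (G.Z0 zl / zγ i + 1) < zγ i * t i ^ 2 :=
        mul_lt_mul_of_pos_left (lt_of_lt_of_le hbig hsq) hz
      linarith
    have h0 : G.energy zl zγ t₀ ≤ G.Z0 zl := by
      rw [← energy_zero (G := G) (zγ := zγ)]; exact hmin h0S
    linarith

/-- Adding a current s through one chord i shifts the line currents under it by −s. [cite: Volkov2020, §2.2.1 (journal p.9)] -/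
theorem lineCurrent_add_singleChord {i : ℕ × ℕ} (hi : i ∈ G.ph) (t : ℕ × ℕ → ℝ) (s : ℝ) (k : ℕ) :
    G.lineCurrent (fun j => t j + singleChord i s j) k = G.lineCurrent t k - if k ∈ Finset.Ico i.1 i.2 then s else 0 := by
  have h := lineCurrent_singleChord (G := G) hi s k
  unfold lineCurrent at h ⊢
  rw [Finset.sum_add_distrib]
  linarith

/-- The power along the one-chord perturbation t + s·𝟙_i is the parabola energy(t) + 2s·L_i + s²·Q_i with L_i = z_i t_i − Σ_{k∈LPath(i)} z_k i_k
(the voltage-law defect) and Q_i = z_i + z″_i > 0. [cite: Grimmett2018, Ch. 1 proof of Thm 1.28] -/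
theorem energy_add_singleChord {i : ℕ × ℕ} (hi : i ∈ G.ph) (t : ℕ × ℕ → ℝ) (s : ℝ) :
    G.energy zl zγ (fun j => t j + singleChord i s j) = G.energy zl zγ t +
      2 * s * (zγ i * t i - ∑ k ∈ Finset.Ico i.1 i.2, zl k * G.lineCurrent t k) + s ^ 2 * (zγ i + zSum zl i) := by
  unfold energy zSum
  have ek : ∀ k ∈ range G.N, zl k * G.lineCurrent (fun j => t j + singleChord i s j) k ^ 2 =
      zl k * G.lineCurrent t k ^ 2 +
        (if k ∈ Finset.Ico i.1 i.2 then -(2 * s) * (zl k * G.lineCurrent t k) + s ^ 2 * zl k else 0) := fun k _ => by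
    rw [lineCurrent_add_singleChord hi]
    by_cases hk : k ∈ Finset.Ico i.1 i.2
    · rw [if_pos hk, if_pos hk]; ring
    · rw [if_neg hk, if_neg hk]; ring
  have ej : ∀ j ∈ G.ph, zγ j * (t j + singleChord i s j) ^ 2 =
      zγ j * t j ^ 2 + (if j = i then 2 * s * (zγ i * t i) + s ^ 2 * zγ i else 0) := fun j _ => by
    unfold singleChord
    by_cases hj : j = i
    · subst hj; rw [if_pos rfl, if_pos rfl]; ring
    · rw [if_neg hj, if_neg hj]; ring
  have e3 : ∑ k ∈ Finset.Ico i.1 i.2, (-(2 * s) * (zl k * G.lineCurrent t k) + s ^ 2 * zl k) =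
      -(2 * s) * ∑ k ∈ Finset.Ico i.1 i.2, zl k * G.lineCurrent t k + s ^ 2 * ∑ k ∈ Finset.Ico i.1 i.2, zl k := by
    rw [Finset.sum_add_distrib, ← Finset.mul_sum, ← Finset.mul_sum]
  rw [Finset.sum_congr rfl ek, Finset.sum_congr rfl ej, Finset.sum_add_distrib, Finset.sum_add_distrib, Finset.sum_ite_mem,
    Finset.inter_eq_right.2 (Ico_subset_range hi), e3, Finset.sum_ite_eq' G.ph i, if_pos hi]
  ring

/-- **A minimiser obeys Kirchhoff's voltage law** (first variation along each chord cycle: the parabola 2sL + s²Q is ≥ 0 for all s only if L = 0).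
[cite: Grimmett2018, Ch. 1 Thm 1.28] [cite: LyonsPeres2016, §2.4] -/
theorem KVL_of_isMin (hzl : ∀ k, 0 < zl k) (hzγ : ∀ i, 0 < zγ i) {t₀ : ℕ × ℕ → ℝ}
    (hmin : ∀ t, G.energy zl zγ t₀ ≤ G.energy zl zγ t) : G.KVL zl zγ t₀ := by
  intro i hi
  set L := zγ i * t₀ i - ∑ k ∈ Finset.Ico i.1 i.2, zl k * G.lineCurrent t₀ k with hL
  set Q := zγ i + zSum zl i with hQ
  have hQ0 : 0 < Q := by
    have h1 := hzγ i
    have h2 : 0 ≤ zSum zl i := Finset.sum_nonneg fun k _ => (hzl k).le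
    linarith
  have h := hmin (fun j => t₀ j + singleChord i (-L / Q) j)
  rw [energy_add_singleChord hi] at h
  have e : 2 * (-L / Q) * L + (-L / Q) ^ 2 * Q = -(L ^ 2 / Q) := by
    field_simp
    ring
  have hle : L ^ 2 / Q ≤ 0 := by linarith
  have hL2 : L ^ 2 ≤ 0 := by
    by_contra hpos
    exact absurd hle (not_le.2 (div_pos (lt_of_not_ge hpos) hQ0))
  have hL0 : L = 0 := by nlinarith [sq_nonneg L]
  rw [hL] at hL0
  linarith

/-- **Kirchhoff's laws have a solution on the lepton-path circuit** (existence of the physical current distribution).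
[cite: Grimmett2018, Ch. 1 Thm 1.28] [cite: Volkov2020, §2.2.1 (journal p.9)] -/
theorem exists_KVL (hzl : ∀ k, 0 < zl k) (hzγ : ∀ i, 0 < zγ i) : ∃ t₀ : ℕ × ℕ → ℝ, G.KVL zl zγ t₀ := by
  obtain ⟨t₀, h⟩ := exists_isMin (G := G) hzl hzγ
  exact ⟨t₀, KVL_of_isMin hzl hzγ h⟩

/-- **Z (Thomson form) = the resistance between the external vertices, unconditionally**: there is a current distribution obeying Kirchhoff's
laws, it attains the infimum, and Z equals its voltage drop Σ_k z_k·i_k between vertex 0 and vertex N at unit current.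
[cite: Grimmett2018, Ch. 1 Lemma 1.25, Thm 1.28] [cite: Volkov2020, eq. (2.4) «Z(z) is the resistance between the vertexes that are incident to
the external lepton lines» (journal p.10; tex l.261–264)] -/
theorem effRes_is_resistance (hzl : ∀ k, 0 < zl k) (hzγ : ∀ i, 0 < zγ i) :
    ∃ t₀ : ℕ × ℕ → ℝ, G.KVL zl zγ t₀ ∧ G.effRes zl zγ = G.energy zl zγ t₀ ∧
      G.effRes zl zγ = ∑ k ∈ range G.N, zl k * G.lineCurrent t₀ k := by
  obtain ⟨t₀, h⟩ := exists_KVL (G := G) hzl hzγ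
  exact ⟨t₀, h, effRes_eq_energy_of_KVL hzl hzγ h, effRes_eq_voltage_of_KVL hzl hzγ h⟩

end Existence

end PathSkeleton

end Literature.MathematicalPhysics.QuantumFieldTheory.Volkov2020
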